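/-
Copyright (c) 2026 the pub-hodgecm-mathlib formalisation cell (harness21).  Prover seat hodgecm-mathlib-K2E3-p16 (g0), 2026-09-03.  Track B «K2-LIT», engine E3, WILD CHAIN
(K2E3-plan (g1) BATCH #2, line lead K2E3-p17 (g0)): THE W₂ PAYER — the cross-trace-zero socket at a WILD place, and its guard-free junction.
-/
import Summits.HodgeConjecture.HodgeConjecture.Theorems.K2E3EPCrossNormZeroExplicitWild            -- ★ NW-B-W FILE 2 p855403 (K2E4-p21): §3-W `innerG_char_cross_eq_zero_of_ramificationIdx_ne_one_explicit_of_h61` (brings ★ NW-B-W FILE 1 p855364, ★ 58-W-W p855272, ★ (A)-W, ★ 59-W(C), ★ H-W, ★ 53-W, ★ 48-W∕1∕2)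
import Summits.HodgeConjecture.HodgeConjecture.Theorems.K2E3EPInducedTraceZeroAtDatumDischargeWild -- ★ 61b-W p855428 (this seat): `smoothTrace_cmPrincipalSeries_epFunction_eq_zero_of_ramificationIdx_ne_one` — the `h61` letter
import Summits.HodgeConjecture.HodgeConjecture.Theorems.F0P3cStCharTSEPCrossNormZeroNotWild       -- ★ (X0′-NW) p853794 (LH6-p03): `innerG_char_cross_eq_zero_of_not_wild` (the not-wild branch of §2) + ★ `isUnramifiedIn_of_ramificationIdx'_eq_one`
import HarnessLib

/-!
# K2 · E3 · WILD CHAIN · W₂ — `K2E3InnerGCharCrossEqZeroWild`: THE CROSS-TRACE-ZERO `⟨χ_⟦r′⟧, χ_⟦r⟧⟩_e = 0` AT A WILD PLACE (socket `U5Kazhdan.sig_K2E3InnerGCharCrossEqZeroWild`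
# of ED. 2 BY NAME) and the GUARD-FREE junction at every non-split place

Cell `pub/hodgecm-mathlib` (D-0151), Track B «K2-LIT», crux H413 = `stmt-HodgeConjecture-24833` (lane `--kind proof --supports … --as helper`: THEOREMS ONLY — no definition ∕
instance ∕ notation ∕ named fact ∕ `sorry`; count-neutral); route of record `HCCMUnconditional`; seat K2E3-p16 (g0); namespace
`Summit.HodgeConjecture.HodgeConjecture.Cruxes.H413.K2E3InnerGCharCrossEqZeroWild`.  ★-only imports (never a `Cruxes/…/Lines` module).

THE MATHEMATICS ([SchneiderStuhler1997 §III.4]; [Kottwitz1988 §2]; [Rogawski1990 §12.6 p. 187, Prop. 12.6.1 (b) p. 188]) is ★ (X0′)'s, read at a WILD (dyadic ramified) place: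
for irreducible smooth `π = [r]`, `π′ = [r′]` of `G = U(Φ₃)(L⁺_v)` the Euler–Poincaré function `f_EP^π` of the Schneider–Stuhler resolution on the WILD lattice tree (Track A U0's
ramified quadratic datum, any residue characteristic) is a pseudo-coefficient of `π` (★ 58-W-W), so `⟨χ_{π′}, χ_π⟩_e = tr π′(f_EP^π) = dim Hom(C₀^π, π′) − dim Hom(C₁^π, π′)`; if
every smooth extension `0 → π′ → E → π → 0` splits and `Hom_G(π, π′) = 0`, this is `0` (★ NW-B-W).  This file only ASSEMBLES: it picks the place `w ∣ v`, the one-place model `eA`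
(★ `localNonsplitEquiv` re-read on `Φ₃`, as ★ (X0′-NW) :93–:101), reads `e(w∣v) ≠ 1` off the wild token (contrapositive of ★ `isUnramifiedIn_of_ramificationIdx'_eq_one`), takes
ANY uniformiser `ϖ` (★ `valuation_exists_uniformizer`), and calls ★ NW-B-W §3-W `…_explicit_of_h61` with `h61 :=` ★ 61b-W partially applied.

* §1 **`innerG_char_cross_eq_zero_of_wild (hns) (hw : ¬ (v unr ∨ |2|_v = 1)) …`** — binders = ★ (X0′-NW) `innerG_char_cross_eq_zero_of_not_wild`'s VERBATIM with the place token
  replaced IN ITS SLOT by its negation; conclusion VERBATIM.  **= socket W₂ `U5Kazhdan.sig_K2E3InnerGCharCrossEqZeroWild` (cand `K2/K2E3-p16/g0/sig_K2E3WildEllipticKernel.cand…`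
  82ee481863d71ae1, ADOPTED by K2E3-plan (g1) 22:15:20Z) BY NAME** — tie probe at home `rfl`.
* §2 **`innerG_char_cross_eq_zero_of_nonsplit (hns) …`** — the place token GONE: not wild ⇒ ★ (X0′-NW); wild ⇒ §1.  This is the `hX0` letter of ★
  `K2E3EllipticInnerNonzeroIsPairOfCrossWild.isEllipticPair_of_innerG_ne_zero_of_cross` (p855204) at EVERY non-split place.
CONSUMERS: `sig_K2E3EllipticInnerNonzeroIsPair` (#16) := ★ p855204 `ellipticInnerNonzeroIsPair_of_crossWild stub2 stub4 §1` (filed next as `K2E3EllipticInnerNonzeroIsPairOfStubs`);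
row #15's cross half (K2E3-p15's ★ p855128 `kazhdanWildResidual_of_epWildHeads`).
HONEST LABEL: count-neutral helper; it pays W₂ of U5Kazhdan ED. 2 by name once that edition is written (K2E3-plan (g1)); h413 OPEN; HC_CM is proved only modulo the 7 printed citations
(2 remaining named inputs hLiu418 = `stmt-HodgeConjecture-24832`, h413 = `stmt-HodgeConjecture-24833`) until rung 0 closes; nothing printed is asserted here.

## References
* [Rogawski1990] J. D. Rogawski, *Automorphic Representations of Unitary Groups in Three Variables*, Ann. of Math. Stud. 123 (1990): §12.6 p. 187, Prop. 12.6.1 (b) p. 188.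
* [SchneiderStuhler1997] P. Schneider, U. Stuhler, *Representation theory and sheaves on the Bruhat–Tits building*, Publ. Math. IHÉS 85 (1997): §III.4 Thm. III.4.16.
* [Kottwitz1988] R. E. Kottwitz, *Tamagawa numbers*, Ann. of Math. 127 (1988): §2 Theorem 2 (no tameness hypothesis).
* [Tits1979] J. Tits, *Reductive groups over local fields*, PSPM 33.1 (1979), §2.7 (the ramified quasi-split `²A₂`).
-/

set_option autoImplicit false
-- the mandated namespace has the single-problem summit's repeated segment (`HodgeConjecture.HodgeConjecture`)
set_option linter.dupNamespace false

noncomputable section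

open NumberField IsDedekindDomain MeasureTheory Filter Topology
open scoped Matrix MatrixGroups Pointwise Valued WithZero ComplexConjugate
open Literature.NumberTheory.Rogawski1990 Literature.NumberTheory.Rogawski1990.Ch12Sec5
open Literature.NumberTheory.Automorphic Literature.NumberTheory.Automorphic.UnitaryGroup Literature.NumberTheory.Automorphic.UnitaryLatticeTree
open Literature.NumberTheory.Automorphic.HermitianLattice
open Literature.NumberTheory.GaloisRepresentations
open Literature.Combinatorics.SimpleGraph Literature.Combinatorics.SimpleGraph.OrientedIncidence
open Literature.NumberTheory.Automorphic.Liu2021.LemD1IndexedNonVacuityTameSynthesis (isUnramifiedIn_of_ramificationIdx'_eq_one)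

namespace Summit.HodgeConjecture.HodgeConjecture.Cruxes.H413.K2E3InnerGCharCrossEqZeroWild
open Summit.HodgeConjecture.HodgeConjecture.Cruxes.H413 Summit.HodgeConjecture.HodgeConjecture.Cruxes.H413.F0P3cStCharTSTorusDefs

section Head

variable (L : Type) [Field L] [NumberField L] [IsCMField L] (v : HeightOneSpectrum (𝓞 ↥(maximalRealSubfield L)))

/-! ## §1 CROSS-TRACE-ZERO AT A WILD PLACE — socket W₂ BY NAME -/

set_option maxHeartbeats 1600000 in
/-- **W₂ — CROSS-TRACE-ZERO AT A WILD PLACE** (socket `U5Kazhdan.sig_K2E3InnerGCharCrossEqZeroWild` BY NAME; the `hv ↦ hw` twin of ★ (X0′-NW)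
`innerG_char_cross_eq_zero_of_not_wild`): at a non-split `v` with `hw : ¬ (v unramified in L ∨ |2|_v = 1)`, at the §12.5 datum with the junction pins `hμG horb hreg hE hM1` and ★
PCT-OUT's letters `hWIF hC1 hC2 hC3 hL2`, for irreducible smooth `r, r′` of `U(Φ₃)(L⁺_v)` with `hsplit₂` (every smooth extension of `r` by `r′` splits) and `hHom0` (`Hom_G(r, r′) = 0`):
**`⟨χ_⟦r′⟧, χ_⟦r⟧⟩_e = 0`**.  Proof: the place `w ∣ v` (★ `hns`), `e(w∣v) ≠ 1` from `hw` (★ `isUnramifiedIn_of_ramificationIdx'_eq_one`, contrapositive), any uniformiser (★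
`valuation_exists_uniformizer`), the one-place model `eA` (★ `localNonsplitEquiv` on `Φ₃`), then ★ NW-B-W §3-W `innerG_char_cross_eq_zero_of_ramificationIdx_ne_one_explicit_of_h61` with
`h61 :=` ★ 61b-W `smoothTrace_cmPrincipalSeries_epFunction_eq_zero_of_ramificationIdx_ne_one L v νQv w hw′ he hϖ eA`.
[cite: Rogawski1990, §12.6 p. 187; Prop. 12.6.1 (b) p. 188] [cite: SchneiderStuhler1997, §III.4 Thm. III.4.16] [cite: Kottwitz1988, §2 Thm. 2] -/
theorem innerG_char_cross_eq_zero_of_wild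
    (hns : ∀ w : PlacesOver L v, IsCMField.complexConj L • w.1 = w.1) (hw : ¬ (Algebra.IsUnramifiedIn (𝓞 L) v.asIdeal ∨ Valued.v (2 : v.adicCompletion ↥(maximalRealSubfield L)) = 1))
    [MeasurableSpace (Gqs L v)] [BorelSpace (Gqs L v)]
    [∀ γ : Gqs L v, MeasurableSpace (Gqs L v ⧸ Subgroup.centralizer ({γ} : Set (Gqs L v)))] [∀ γ : Gqs L v, BorelSpace (Gqs L v ⧸ Subgroup.centralizer ({γ} : Set (Gqs L v)))]
    [MeasurableSpace (Gqs L v ⧸ Subgroup.center (Gqs L v))]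
    {H : Type} [Group H] [TopologicalSpace H] [IsTopologicalGroup H] [MeasurableSpace H]
    (νQv : Measure (Gqs L v)) [νQv.IsHaarMeasure] [νQv.IsMulRightInvariant] (mQv : OrbitalMeasureFamily (Gqs L v))
    (hcanQ : mQv.IsCanonical (fun γ => IsRegularElt (γ.val : GL (Fin 3) (UnitaryGroup.LocalRing L v))) νQv)
    (𝔇 : EllipticData (Gqs L v) H) (hμG : 𝔇.μG = νQv) (horb : 𝔇.orb = mQv)
    (hreg : ∀ γ : Gqs L v, γ ∈ 𝔇.regG ↔ IsRegularElt (γ.val : GL (Fin 3) (UnitaryGroup.LocalRing L v)))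
    (hE : ∀ γ : Gqs L v, γ ∈ 𝔇.ellG ↔ IsRegularElt (γ.val : GL (Fin 3) (UnitaryGroup.LocalRing L v)) ∧ γ ∉ hyperbolicSet L v)
    (hM1 : ∀ π : IrrClass (Gqs L v), Measurable (𝔇.char π) ∧ LocallyIntegrable (𝔇.char π) 𝔇.μG ∧ (∀ x ∈ 𝔇.regG, ∀ᶠ y in 𝓝 x, 𝔇.char π y = 𝔇.char π x) ∧
      ∀ φ : Gqs L v → ℂ, IsLocSmooth φ → π.smoothTrace 𝔇.μG φ = ∫ x, φ x * 𝔇.char π x ∂𝔇.μG)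
    (hWIF : 𝔇.WeylIntegrationFormula) (hC1 : 𝔇.EllCartanSubset) (hC2 : 𝔇.EllCartanAE) (hC3 : 𝔇.NonEllCartanAE) (hL2 : 𝔇.L2CharOnTorusAll)   -- ★ PCT-OUT's extra letters
    (r : SmoothIrrep (Gqs L v))
    -- the CROSS letters: a second irreducible smooth `r′`; every SMOOTH extension of `r.ρ` BY `r′.ρ` splits (★ (J′)'s text at `V := r.ρ`, `W := r′.ρ`); `Hom_G(r, r′) = 0`
    (r' : SmoothIrrep (Gqs L v))
    (hsplit₂ : ∀ (E : Type) [AddCommGroup E] [Module ℂ E] (ρE : Representation ℂ (Gqs L v) E), ρE.IsSmooth →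
      ∀ (i : r'.ρ.IntertwiningMap ρE) (p : ρE.IntertwiningMap r.ρ), Function.Injective i → LinearMap.ker p.toLinearMap = LinearMap.range i.toLinearMap →
        Function.Surjective p → ∃ s : r.ρ.IntertwiningMap ρE, p.comp s = Representation.IntertwiningMap.id r.ρ)
    (hHom0 : Subsingleton (r.ρ.IntertwiningMap r'.ρ)) :
    𝔇.innerG (𝔇.char (IrrClass.mk r')) (𝔇.char (IrrClass.mk r)) = 0 := by
  obtain ⟨w⟩ : Nonempty (PlacesOver L v) := inferInstance
  have hw' : IsCMField.complexConj L • w.1 = w.1 := hns w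
  have hc1 : IsCMField.complexConj L ≠ 1 := IsCMField.complexConj_ne_one L
  haveI : Algebra.IsQuadraticExtension ↥(maximalRealSubfield L) L := IsCMField.isQuadraticExtension L
  -- the wild token ⇒ `e(w∣v) ≠ 1`
  have he : v.asIdeal.ramificationIdx' w.1.asIdeal ≠ 1 := fun h1 =>
    hw (Or.inl (isUnramifiedIn_of_ramificationIdx'_eq_one L (IsCMField.complexConj L) v hc1 w hw' h1))
  -- any uniformiser of `L_w`
  obtain ⟨π, hπ⟩ := w.1.valuation_exists_uniformizer L
  have hϖ : Valued.v (π : w.1.adicCompletion L) = WithZero.exp (-1 : ℤ) := by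
    rw [HeightOneSpectrum.valuedAdicCompletion_eq_valuation', hπ]
  -- the one-place model re-read on the literal form `Φ₃ = antidiag(1,1,1)` (★ (X0′-NW) :93–:101)
  have hJw : placeForm (qsForm L) w.1 = (StdForm.antidiagonal 3).over (w.1.adicCompletion L) := by
    rw [placeForm, qsForm, antidiagOne_eq_over, StdForm.over_map]
  obtain ⟨eA, heA⟩ : ∃ eA : Gqs L v ≃ₜ* ↥(unitaryGroupOfForm (galAdicCompletionMap (L := L) (IsCMField.complexConj L) hw') ((StdForm.antidiagonal 3).over (w.1.adicCompletion L))),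
      ∀ g : Gqs L v, ((eA g : ↥(unitaryGroupOfForm (galAdicCompletionMap (L := L) (IsCMField.complexConj L) hw') ((StdForm.antidiagonal 3).over (w.1.adicCompletion L)))) :
          GL (Fin 3) (w.1.adicCompletion L)) =
        ((localNonsplitEquiv (IsCMField.complexConj L) (qsForm L) hc1 w hw' g :
          ↥(unitaryGroupOfForm (galAdicCompletionMap (L := L) (IsCMField.complexConj L) hw') (placeForm (qsForm L) w.1))) : GL (Fin 3) (w.1.adicCompletion L)) := by
    rw [← hJw]
    exact ⟨localNonsplitEquiv (IsCMField.complexConj L) (qsForm L) hc1 w hw', fun g => rfl⟩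
  exact K2E3EPCrossNormZeroExplicitWild.innerG_char_cross_eq_zero_of_ramificationIdx_ne_one_explicit_of_h61 L v hns w hw' he hϖ eA heA νQv mQv hcanQ 𝔇
    hμG horb hreg hE hM1
    (K2E3EPInducedTraceZeroAtDatumDischargeWild.smoothTrace_cmPrincipalSeries_epFunction_eq_zero_of_ramificationIdx_ne_one L v νQv w hw' he hϖ eA)
    hWIF hC1 hC2 hC3 hL2 r r' hsplit₂ hHom0

/-! ## §2 CROSS-TRACE-ZERO AT EVERY NON-SPLIT PLACE, NO GUARD -/

set_option maxHeartbeats 1600000 in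
/-- **CROSS-TRACE-ZERO AT EVERY NON-SPLIT PLACE, NO PLACE TOKEN** (the `hX0` letter of ★ `K2E3EllipticInnerNonzeroIsPairOfCrossWild.isEllipticPair_of_innerG_ne_zero_of_cross`):
binders = ★ (X0′-NW)'s with `hv` DROPPED, conclusion VERBATIM; proof = case split — not wild ⇒ ★ `innerG_char_cross_eq_zero_of_not_wild`, wild ⇒ §1.
[cite: Rogawski1990, §12.6 p. 187; Prop. 12.6.1 (b) p. 188] [cite: SchneiderStuhler1997, §III.4 Thm. III.4.16] [cite: Kottwitz1988, §2 Thm. 2] -/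
theorem innerG_char_cross_eq_zero_of_nonsplit
    (hns : ∀ w : PlacesOver L v, IsCMField.complexConj L • w.1 = w.1)
    [MeasurableSpace (Gqs L v)] [BorelSpace (Gqs L v)]
    [∀ γ : Gqs L v, MeasurableSpace (Gqs L v ⧸ Subgroup.centralizer ({γ} : Set (Gqs L v)))] [∀ γ : Gqs L v, BorelSpace (Gqs L v ⧸ Subgroup.centralizer ({γ} : Set (Gqs L v)))]
    [MeasurableSpace (Gqs L v ⧸ Subgroup.center (Gqs L v))]
    {H : Type} [Group H] [TopologicalSpace H] [IsTopologicalGroup H] [MeasurableSpace H]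
    (νQv : Measure (Gqs L v)) [νQv.IsHaarMeasure] [νQv.IsMulRightInvariant] (mQv : OrbitalMeasureFamily (Gqs L v))
    (hcanQ : mQv.IsCanonical (fun γ => IsRegularElt (γ.val : GL (Fin 3) (UnitaryGroup.LocalRing L v))) νQv)
    (𝔇 : EllipticData (Gqs L v) H) (hμG : 𝔇.μG = νQv) (horb : 𝔇.orb = mQv)
    (hreg : ∀ γ : Gqs L v, γ ∈ 𝔇.regG ↔ IsRegularElt (γ.val : GL (Fin 3) (UnitaryGroup.LocalRing L v)))
    (hE : ∀ γ : Gqs L v, γ ∈ 𝔇.ellG ↔ IsRegularElt (γ.val : GL (Fin 3) (UnitaryGroup.LocalRing L v)) ∧ γ ∉ hyperbolicSet L v)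
    (hM1 : ∀ π : IrrClass (Gqs L v), Measurable (𝔇.char π) ∧ LocallyIntegrable (𝔇.char π) 𝔇.μG ∧ (∀ x ∈ 𝔇.regG, ∀ᶠ y in 𝓝 x, 𝔇.char π y = 𝔇.char π x) ∧
      ∀ φ : Gqs L v → ℂ, IsLocSmooth φ → π.smoothTrace 𝔇.μG φ = ∫ x, φ x * 𝔇.char π x ∂𝔇.μG)
    (hWIF : 𝔇.WeylIntegrationFormula) (hC1 : 𝔇.EllCartanSubset) (hC2 : 𝔇.EllCartanAE) (hC3 : 𝔇.NonEllCartanAE) (hL2 : 𝔇.L2CharOnTorusAll)   -- ★ PCT-OUT's extra letters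
    (r : SmoothIrrep (Gqs L v))
    -- the CROSS letters: a second irreducible smooth `r′`; every SMOOTH extension of `r.ρ` BY `r′.ρ` splits (★ (J′)'s text at `V := r.ρ`, `W := r′.ρ`); `Hom_G(r, r′) = 0`
    (r' : SmoothIrrep (Gqs L v))
    (hsplit₂ : ∀ (E : Type) [AddCommGroup E] [Module ℂ E] (ρE : Representation ℂ (Gqs L v) E), ρE.IsSmooth →
      ∀ (i : r'.ρ.IntertwiningMap ρE) (p : ρE.IntertwiningMap r.ρ), Function.Injective i → LinearMap.ker p.toLinearMap = LinearMap.range i.toLinearMap →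
        Function.Surjective p → ∃ s : r.ρ.IntertwiningMap ρE, p.comp s = Representation.IntertwiningMap.id r.ρ)
    (hHom0 : Subsingleton (r.ρ.IntertwiningMap r'.ρ)) :
    𝔇.innerG (𝔇.char (IrrClass.mk r')) (𝔇.char (IrrClass.mk r)) = 0 := by
  by_cases hv : Algebra.IsUnramifiedIn (𝓞 L) v.asIdeal ∨ Valued.v (2 : v.adicCompletion ↥(maximalRealSubfield L)) = 1
  · exact F0P3cStCharTSEPCrossNormZeroNotWild.innerG_char_cross_eq_zero_of_not_wild L v hns hv νQv mQv hcanQ 𝔇 hμG horb hreg hE hM1 hWIF hC1 hC2 hC3 hL2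
      r r' hsplit₂ hHom0
  · exact innerG_char_cross_eq_zero_of_wild L v hns hv νQv mQv hcanQ 𝔇 hμG horb hreg hE hM1 hWIF hC1 hC2 hC3 hL2 r r' hsplit₂ hHom0

end Head

end Summit.HodgeConjecture.HodgeConjecture.Cruxes.H413.K2E3InnerGCharCrossEqZeroWild

end
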